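import Summits.Ventures.Crystal3D.Theorems.StickyWulffConstantGenericWallFloorEndBallDefectSite
import Summits.Ventures.Crystal3D.Theorems.StickyWulffConstantGenericWallFloorEndBallBlocker
import HarnessLib

/-!
# THE §51 END-BALL ROW: at every stopped walker — an ADDABLE empty slot (vacancy row), a FAR blocker, a PAYER within `2 + √3`,
# or an exact ON-MENU blocker (crux `GenericWallFloor`, stmt-Ventures-19480, line `WallLedgerG`; cf-p1 (xlii″) (G-iv) 2026-08-28T22:08Z
# «19480-p2 states the vacancy-keyed dichotomy, 19480-p1 consumes it as the VacancyCage-type row of the EndBallClass interface»)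

HONEST FRAMING. Venture `Summits/Ventures/Crystal3D` (cell `crystal3d-full`), helper `--supports` the crux `GenericWallFloor` of
`route-Ventures-StickyWulffConstant`, REGISTERED line `WallLedgerG`, open stub `stub_twoSlabAdhesion`.  Rung credit only; F-C1 not moved;
NOT the crux; no ledger arithmetic.  Census-free, standard axioms; GAP/CLASSIFICATION (`δ ≥ 5/2`) enter the count row as upstream.

THE COMPOSITION (19480-p2's `endBall_second_centre`, …EndBallDefectSite ∘ this seat's `blocker_mem_blockerSites_or_payer`, …EndBallBlocker):
a stopped walker at `y` (top frame `F = e.frame`) has an EMPTY exact slot `i` (`y + F·slotSite i ∉ X`), and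
* **`endBall_row`** (COUNT form: `deg y ≤ k + 1`, `k` = the number of occupied `F`-slots of `y` — all certified by the walk): the empty
  site `q = y + F·slotSite i` is
  (A) ADDABLE — every ball of `X` is at distance `≥ 1` from `q`; then EVERY ball touching `q` has `≤ 11` contacts and at most `12` balls
      touch `q` (the VACANCY ROW, keyed on `q`, multiplicity `≤ 12`); OR
  (F) blocked by a FAR ball `b ∈ X`, `dist q b < 1`, `√3 < dist b y < 2` (the honest radius gap of the universe lemma); OR
  (P) a PAYER `p ∈ X`, `p ≠ y`, `dist y p ≤ 2 + √3`, `deg p ≤ 11` exists (off-menu blocker within `√3`; multiplicity `≤ 606`,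
      …PayerMultiplicity); OR
  (E) blocked ON THE MENU: a ball `y + F·pointVec q′ ∈ X` with `q′ ∈ blockerSites i`, `q′ ≠ 3 • slotInt i` (one of the six twin-contact /
      twin-`√2` sites of the slot: the EXACT branch, whose configurations are the 487 patterns of …EndBallExactPatternsA/B).
* **`endBall_row_any`** (no count hypothesis — covers the residual «defective twin caps», `deg y ≥ k + 2`): (A), or (F), or
  (N) a NEAR off-slot blocker `b ∈ X`, `b ≠ y`, `dist b y ≤ √3`, `dist q b < 1`, at no exact slot site of `y` — the raw second centre of
  19480-p2, to which the vacancy/mirror-site rows of …EndBallDefectSite apply.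
WHAT THIS IS NOT: no ledger inequality is summed here (the multiplicities `≤ 12 / ≤ 606` and the exact table are cited, not combined); F-C1 not moved.
-/

noncomputable section

namespace Summit.Ventures.Crystal3D.Theorems

open Summit.Ventures.Crystal3D Finset NearIdentity
open scoped InnerProductSpace

variable {X : Finset (EuclideanSpace ℝ (Fin 3))}

/-- **THE END-BALL ROW (count form).**  See the module docstring: (A) addable vacancy ∨ (F) far blocker ∨ (P) payer within `2 + √3` ∨
(E) exact on-menu blocker, at an empty slot `i` of the stopped walker's ball `y`. -/
theorem endBall_row {δ : ℝ} (hg : KissingGap δ) (hc : KissingClassification δ) (hδ : 5 / 2 ≤ δ)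
    (hX : ∀ p ∈ X, ∀ q ∈ X, p ≠ q → 1 ≤ dist p q)
    {z y : EuclideanSpace ℝ (Fin 3)} {e : WalkEntry} {rest : List WalkEntry} (h : walkStep X z (y, e :: rest) = none) (hy : y ∈ X)
    (hdeg : (X.filter fun q => dist y q = 1).card ≤ (Finset.univ.filter fun i : Fin 12 => y + e.frame (slotSite i) ∈ X).card + 1) :
    ∃ i : Fin 12, y + e.frame (slotSite i) ∉ X ∧
      (((∀ b ∈ X, 1 ≤ dist (y + e.frame (slotSite i)) b) ∧
          (∀ b ∈ X, dist b (y + e.frame (slotSite i)) = 1 → (X.filter fun p => dist b p = 1).card ≤ 11) ∧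
          (X.filter fun b => dist b (y + e.frame (slotSite i)) = 1).card ≤ 12) ∨
        (∃ b ∈ X, dist (y + e.frame (slotSite i)) b < 1 ∧ Real.sqrt 3 < dist b y ∧ dist y b < 2) ∨
        (∃ p ∈ X, p ≠ y ∧ dist y p ≤ 2 + Real.sqrt 3 ∧ (X.filter fun q => dist p q = 1).card ≤ 11) ∨
        (∃ q' ∈ blockerSites i, q' ≠ 3 • slotInt i ∧ y + e.frame (pointVec q') ∈ X ∧
          dist (y + e.frame (slotSite i)) (y + e.frame (pointVec q')) < 1)) := by
  classical
  obtain ⟨w, hw, hq, hd, hcase⟩ := endBall_second_centre hX h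
  obtain ⟨i, rfl⟩ := exists_slotSite_eq hw
  refine ⟨i, hq, ?_⟩
  rcases hcase with hA | ⟨b, hbX, hb, hyb, hoff⟩
  · exact Or.inl hA
  right
  by_cases hfar : Real.sqrt 3 < dist b y
  · exact Or.inl ⟨b, hbX, hb, hfar, hyb⟩
  right
  push Not at hfar
  have hby : b ≠ y := by
    intro hby
    rw [hby, dist_comm, hd] at hb
    exact lt_irrefl _ hb
  set S := Finset.univ.filter fun j : Fin 12 => y + e.frame (slotSite j) ∈ X with hS
  have hSX : ∀ j ∈ S, y + e.frame (slotSite j) ∈ X := fun j hj => (Finset.mem_filter.1 hj).2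
  rcases blocker_mem_blockerSites_or_payer hg hc hδ hX e.frame hy S hSX hdeg hbX hby hfar i
      (by rw [dist_comm]; exact hb) with ⟨p, hp, hpy, hbp, hp11⟩ | ⟨q', hq', hbq⟩
  · left
    refine ⟨p, hp, hpy, ?_, hp11⟩
    calc dist y p ≤ dist y b + dist b p := dist_triangle _ _ _
      _ ≤ Real.sqrt 3 + 2 := add_le_add (by rw [dist_comm]; exact hfar) hbp
      _ = 2 + Real.sqrt 3 := add_comm _ _
  · right
    refine ⟨q', hq', ?_, hbq ▸ hbX, by rw [← hbq]; exact hb⟩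
    intro he
    apply hoff (slotSite i) (slotSite_mem i)
    rw [hbq, he, ← slotSite_eq_pointVec]

/-- **THE END-BALL ROW (any stop, no count hypothesis).**  (A) addable vacancy ∨ (F) far blocker ∨ (N) a near off-slot blocker `b ≠ y`
within `√3` of `y` — the residual «defective twin caps» land in (N) (or (A)/(F)). -/
theorem endBall_row_any (hX : ∀ p ∈ X, ∀ q ∈ X, p ≠ q → 1 ≤ dist p q)
    {z y : EuclideanSpace ℝ (Fin 3)} {e : WalkEntry} {rest : List WalkEntry} (h : walkStep X z (y, e :: rest) = none) :
    ∃ i : Fin 12, y + e.frame (slotSite i) ∉ X ∧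
      (((∀ b ∈ X, 1 ≤ dist (y + e.frame (slotSite i)) b) ∧
          (∀ b ∈ X, dist b (y + e.frame (slotSite i)) = 1 → (X.filter fun p => dist b p = 1).card ≤ 11) ∧
          (X.filter fun b => dist b (y + e.frame (slotSite i)) = 1).card ≤ 12) ∨
        (∃ b ∈ X, dist (y + e.frame (slotSite i)) b < 1 ∧ Real.sqrt 3 < dist b y ∧ dist y b < 2) ∨
        (∃ b ∈ X, b ≠ y ∧ dist b y ≤ Real.sqrt 3 ∧ dist (y + e.frame (slotSite i)) b < 1 ∧
          ∀ j : Fin 12, b ≠ y + e.frame (slotSite j))) := by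
  obtain ⟨w, hw, hq, hd, hcase⟩ := endBall_second_centre hX h
  obtain ⟨i, rfl⟩ := exists_slotSite_eq hw
  refine ⟨i, hq, ?_⟩
  rcases hcase with hA | ⟨b, hbX, hb, hyb, hoff⟩
  · exact Or.inl hA
  right
  by_cases hfar : Real.sqrt 3 < dist b y
  · exact Or.inl ⟨b, hbX, hb, hfar, hyb⟩
  right
  push Not at hfar
  have hby : b ≠ y := by
    intro hby
    rw [hby, dist_comm, hd] at hb
    exact lt_irrefl _ hb
  exact ⟨b, hbX, hby, hfar, hb, fun j => hoff (slotSite j) (slotSite_mem j)⟩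

end Summit.Ventures.Crystal3D.Theorems

end
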